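import Literature.MathematicalPhysics.QuantumFieldTheory.Balaban1983to89.B6Eq24Partition
import Literature.MathematicalPhysics.QuantumFieldTheory.Balaban1983to89.B6LayerCosine

/-!
# `Balaban1983to89.B6Eq211PiSqRefuted` — T. Bałaban, *Propagators and renormalization transformations for lattice
gauge theories. II*, Commun. Math. Phys. **96** (1984) 223–250 [Balaban1984PropagatorsII]: the PRINTED constant `π²`
of the multiscale Poincaré inequality **(2.11)** p. 225 REFUTED on an admitted geometry (the valid constant `8` is
proved in the sibling `…Balaban1983to89.B6Eq211`, same seat)

statement-level skeleton of published theorems with citation tags; proofs where landed; nothing here is a claim about the Yang–Mills mass gap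

PDF held: `paper:balaban1984-cmp96-propagators-rt-ii` (journal page = PDF page + 222); p. 224 [PDF 2] and p. 225
[PDF 3] read from the page renders `run/shared/lean/pub/pub-balaban/b2b-balaban-ref1/pages/1984-cmp96-propagators-rt-
II/…-p002-x2.png`, `…-p003-x2.png`, AS IMAGES.

CITATION HEADER / WHAT IS DECIDED.  Cell `lit-balaban`, Phase 2 seat **p03** (unit `lit-balaban-p03`, HOME
`run/shared/lean/pub/lit-balaban/`), SKELETON row **B6.Eq2.11**, the "refuted-as-printed" half of its status (PHASE2-
TARGETS §G.1: a statement false as printed gets `theorem not_…`).  Printed, p. 225, verbatim: *"More exactly we have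
the inequality ⟨λ, Δλ⟩ ≥ π² Σ_{j=1}^k (L^jη)^{−2} Σ_{x∈B^j(Λ_j)} η^d|λ(x)|², λ ∈ N(Q′), (2.11) as it follows from [3,
2.26, and 2.27]."*; p. 224: *"Let us notice that we admit the case when some domains Ω_j are equal to T_η"*.  The
constant `π²` is inherited from [3] = [Balaban1983RegularityDecay] (2.27) p. 580, where it is the cell's census item
G-B4-03 (the Neumann gap of a block of `s ≥ 2` sites per side is `4s²sin²(π/2s) ∈ [8, π²[` in units of (side)⁻²;
kernel theorem `B4Block227Sharp.not_display227Printed_pi_sq`).  THIS FILE shows that the slip is visible in (2.11)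
itself: in the admitted geometry `k = 1`, `Ω₁ = T_η` = the torus `ℤ/2L × (ℤ/L)^d` made of the two level-1 blocks of
labels `0` and `e₀` (`twoBlock`), the gauge function `λ(x) = cos(π(2x₀+1)/(2L))` (`lamW`; [3]'s block-mean-zero cosine
mode in direction `0`, which is its own even reflection into the second block and is `2L`-periodic) lies in `N(Q′)`
(`nq_lamW`: `Λ₀ = ∅`, both block sums vanish) and has `⟨λ,Δλ⟩ = (2 − 2cos(π/L))‖λ‖² = 4sin²(π/2L)‖λ‖²`
(`energy_lamW`, from the eigen-relation `B6LayerCosine.cosTest_eigen` and periodic summation by parts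
`B4TorusPositivity.grad_term`), whereas the printed right-hand side is `π²L^{−2}‖λ‖² > 4sin²(π/2L)‖λ‖²`
(`B6LayerCosine.sin_bound_lt_pi_sq_div`).  Hence `not_ineq211_pi_sq` (every `L ≥ 2`, every dimension `d + 1 ≥ 1`)
and `not_forall_ineq211_pi_sq`: the sibling's `B6Eq211.ineq211` with `8` replaced by `π²` is FALSE.  Example: `L = 3`,
`d + 1 = 1`: `λ = (√3/2, 0, −√3/2, −√3/2, 0, √3/2)` on `ℤ/6`, energy `3 = ‖λ‖²`, printed bound `π²/9·3 > 3`.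
Nothing downstream in the paper uses the value `π²` (only positivity and an `O(1)` constant), so the defect is
harmless — as G-B4-03 records for [3].

CARRIER: as in `B6Eq24Partition` (lattice units; `T_η` ↦ `B4TorusPositivity.box (per L)`, `per L = (2L, L, …, L)`;
blocks `B4TwoScaleForm.ablock`; `Domains`, `Domains.NQ`, `Domains.blk`); the energy is the forward-bond (torus) energy
`Σ_{x∈T_η}Σ_μ|λ(x+e_μ) − λ(x)|²` of `B6Eq211.ineq211`, identified with `Re Σ_x conj λ(x)·(Δλ)(x)`, `Δ =
B4Green244.negLap 1`, by `B4TorusPositivity.grad_term`.  No definitions beyond the three concrete objects `per`,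
`twoBlock`, `lamW`; no `Prop`-valued fact; `B6Eq24Partition` + `B6LayerCosine` + Mathlib only.
-/

namespace Literature.MathematicalPhysics.QuantumFieldTheory.Balaban1983to89.B6Eq211PiSqRefuted

open scoped Real
open ComplexConjugate
open Literature.MathematicalPhysics.QuantumFieldTheory.Balaban1983to89.B4Green244 (e coarse negLap)
open Literature.MathematicalPhysics.QuantumFieldTheory.Balaban1983to89.B4TwoScaleForm
open Literature.MathematicalPhysics.QuantumFieldTheory.Balaban1983to89.B4TorusKernel (MultiPeriod.translate_apply)
open Literature.MathematicalPhysics.QuantumFieldTheory.Balaban1983to89.B4TorusPositivity (box mem_box IsPeriodic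
  grad_term)
open Literature.MathematicalPhysics.QuantumFieldTheory.Balaban1983to89.B6LayerUpperBound (sum_Ico_int_eq_sum_range)
open Literature.MathematicalPhysics.QuantumFieldTheory.Balaban1983to89.B6LayerCosine (cosTest cosTest_eigen
  sum_cosTest cosTest_zero_pos two_sub_two_cos_eq sin_bound_lt_pi_sq_div)
open Literature.MathematicalPhysics.QuantumFieldTheory.Balaban1983to89.B6Eq24Partition

noncomputable section

variable {d : ℕ}

/-! ## §1 The cosine mode of [3]'s block (cf. `B6LayerCosine`, `B4Block227Sharp`) -/

/-- half-period antisymmetry of the cosine mode: `u(a + L) = −u(a)`. [folklore] -/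
private theorem cosTest_add_L (L : ℕ) (hL : 1 ≤ L) (a : ℤ) : cosTest L (a + L) = -cosTest L a := by
  unfold cosTest
  have hL0 : (L : ℝ) ≠ 0 := by positivity
  have e1 : π * (2 * ((a + L : ℤ) : ℝ) + 1) / (2 * L) = π * (2 * a + 1) / (2 * L) + π := by
    push_cast
    field_simp
    ring
  rw [e1, Real.cos_add_pi]

/-- full-period symmetry: `u(a + 2L·m) = u(a)`. [folklore] -/
private theorem cosTest_add_period (L : ℕ) (hL : 1 ≤ L) (a m : ℤ) :
    cosTest L (a + 2 * L * m) = cosTest L a := by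
  unfold cosTest
  have hL0 : (L : ℝ) ≠ 0 := by positivity
  have e1 : π * (2 * ((a + 2 * L * m : ℤ) : ℝ) + 1) / (2 * L) = π * (2 * a + 1) / (2 * L) + (m : ℤ) * (2 * π) := by
    push_cast
    field_simp
    ring
  rw [e1, Real.cos_add_int_mul_two_pi]

/-- `Σ_{a<L} u(a) = 0` over `Fin L`. [folklore] -/
private theorem sum_fin_cosTest (L : ℕ) (hL : 1 ≤ L) : ∑ a : Fin L, cosTest L ((a : ℕ) : ℤ) = 0 := by
  have h := sum_cosTest hL
  rw [sum_Ico_int_eq_sum_range] at h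
  rw [Fin.sum_univ_eq_sum_range (fun k => cosTest L (k : ℤ)) L]
  exact h

/-- a sum over the cube `[0,L)^{d+1}` of a function of the first coordinate. [folklore] -/
private theorem sum_cube_first (L : ℕ) (f : Fin L → ℝ) :
    ∑ j : Fin (d + 1) → Fin L, f (j 0) = (Fintype.card (Fin d → Fin L) : ℝ) * ∑ a : Fin L, f a := by
  rw [← Fintype.sum_equiv (Fin.consEquiv fun _ : Fin (d + 1) => Fin L)
    (fun p : Fin L × ((i : Fin d) → Fin L) => f p.1) (fun j => f (j 0)) (fun p => by simp [Fin.consEquiv])]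
  rw [Fintype.sum_prod_type, Finset.mul_sum]
  refine Finset.sum_congr rfl fun a _ => ?_
  simp only [Finset.sum_const, Finset.card_univ, nsmul_eq_mul]

/-- on a period box of a periodic `λ`: `Σ_z conj λ(z)·(negLap 1 λ)(z) = Σ_{z,μ}|λ(z+e_μ) − λ(z)|²` (periodic
summation by parts, `B4TorusPositivity.grad_term`; = `B6Eq211.inner_negLap_eq_fwd`, repeated here to keep the two
siblings independent). [folklore] -/
private theorem inner_negLap_eq_fwd' {P : Fin (d + 1) → ℕ} (hP : ∀ i, 1 ≤ P i)
    {lam' : (Fin (d + 1) → ℤ) → ℂ} (hper : IsPeriodic P lam') :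
    ∑ z ∈ box P, conj (lam' z) * negLap 1 lam' z
      = ((∑ z ∈ box P, ∑ μ : Fin (d + 1), ‖lam' (z + e μ) - lam' z‖ ^ 2 : ℝ) : ℂ) := by
  unfold negLap
  push_cast
  simp only [one_pow, one_mul]
  calc ∑ z ∈ box P, conj (lam' z) * ∑ μ : Fin (d + 1), (2 * lam' z - lam' (z + e μ) - lam' (z - e μ))
      = ∑ μ : Fin (d + 1), ∑ z ∈ box P, conj (lam' z) * (2 * lam' z - lam' (z + e μ) - lam' (z - e μ)) := by
        rw [Finset.sum_comm]
        exact Finset.sum_congr rfl fun z _ => Finset.mul_sum _ _ _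
    _ = ∑ μ : Fin (d + 1), ∑ z ∈ box P, ((‖lam' (z + e μ) - lam' z‖ : ℝ) : ℂ) ^ 2 :=
        Finset.sum_congr rfl fun μ _ => grad_term hP hper μ
    _ = _ := Finset.sum_comm

/-! ## §2 The admitted geometry `k = 1`, `Ω₁ = T_η` = a torus of `2 × 1 × ⋯ × 1` blocks, and the witness -/

/-- the periods of `T_η`: `2L` sites in direction `0`, `L` in the others. [folklore] -/
def per (d L : ℕ) : Fin (d + 1) → ℕ := Fin.cons (2 * L) fun _ => L

/-- `per L 0 = 2L`. [folklore] -/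
@[simp] private theorem per_zero (L : ℕ) : per d L 0 = 2 * L := by simp [per]

/-- `per L (i+1) = L`. [folklore] -/
@[simp] private theorem per_succ (L : ℕ) (i : Fin d) : per d L i.succ = L := by simp [per]

/-- membership in the period box of `per`. [folklore] -/
private theorem mem_box_per {L : ℕ} {z : Fin (d + 1) → ℤ} :
    z ∈ box (per d L) ↔ (0 ≤ z 0 ∧ z 0 < 2 * L) ∧ ∀ i : Fin d, 0 ≤ z i.succ ∧ z i.succ < L := by
  rw [mem_box]
  constructor
  · intro h
    refine ⟨?_, fun i => ?_⟩
    · have := h 0; rwa [per_zero, Nat.cast_mul, Nat.cast_two] at this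
    · have := h i.succ; rwa [per_succ] at this
  · rintro ⟨h0, hs⟩ i
    refine Fin.cases ?_ (fun i => ?_) i
    · rw [per_zero, Nat.cast_mul, Nat.cast_two]; exact h0
    · rw [per_succ]; exact hs i

/-- the label of the second block, `e₀ = (1, 0, …, 0)`. [folklore] -/
private theorem e_zero_apply_zero : (e (0 : Fin (d + 1)) : Fin (d + 1) → ℤ) 0 = 1 := by simp [e]

/-- `(e₀)_{i+1} = 0`. [folklore] -/
private theorem e_zero_apply_succ (i : Fin d) : (e (0 : Fin (d + 1)) : Fin (d + 1) → ℤ) i.succ = 0 := by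
  simp [e, Fin.succ_ne_zero]

/-- **THE ADMITTED GEOMETRY** (p. 224: *"we admit the case when some domains Ω_j are equal to T_η"*): `k = 1`, block size
`L`, `T_η = Π ℤ/(per L)` (two `L`-blocks in direction `0`, one in the others), `Ω₁^{(1)}` = both labels `0`, `e₀`, i.e.
`Ω₁ = T_η`. [cite: Balaban1984PropagatorsII, (2.1)–(2.2) p.224] -/
def twoBlock (d L : ℕ) (hL : 1 ≤ L) : Domains (d + 1) where
  L := L
  k := 1
  T := box (per d L)
  Ω := fun _ => {0, e 0}
  one_le_L := hL
  nested := fun j hj hjk => absurd hjk (by omega)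
  sub_T := by
    intro j hj hjk y hy
    obtain rfl : j = 1 := by omega
    intro x hx
    rw [pow_one, ablock, mem_cell] at hx
    rw [mem_box_per]
    have hL' : (0 : ℤ) ≤ L := by positivity
    rcases Finset.mem_insert.mp hy with rfl | hy
    · refine ⟨?_, fun i => ?_⟩
      · have := hx 0; simp only [Pi.zero_apply, mul_zero, zero_add] at this; omega
      · have := hx i.succ; simp only [Pi.zero_apply, mul_zero, zero_add] at this; omega
    · rw [Finset.mem_singleton] at hy
      subst hy
      refine ⟨?_, fun i => ?_⟩
      · have := hx 0; rw [e_zero_apply_zero, mul_one] at this; omega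
      · have := hx i.succ; rw [e_zero_apply_succ, mul_zero, zero_add] at this; omega

/-- **THE WITNESS** `λ(x) = cos(π(2x₀ + 1)/(2L))`: [3]'s block-mean-zero cosine mode in direction `0`, which is its own
even reflection into the second block and `2L`-periodic. [folklore] -/
def lamW (L : ℕ) (z : Fin (d + 1) → ℤ) : ℂ := (cosTest L (z 0) : ℂ)

section Witness

/-- `Ω₁^{(1)} = {0, e₀}`. [folklore] -/
private theorem dom_one (L : ℕ) (hL : 1 ≤ L) : (twoBlock d L hL).dom 1 = {0, e 0} := by
  simp [Domains.dom, twoBlock]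

/-- `Ω₂ = ∅` (`k = 1`). [folklore] -/
private theorem dom_two (L : ℕ) (hL : 1 ≤ L) : (twoBlock d L hL).dom 2 = ∅ := by
  simp [Domains.dom, twoBlock]

/-- every site of `T_η` lies in `Ω₁`: its level-1 label is `0` or `e₀`. [folklore] -/
private theorem coarse_mem (L : ℕ) (hL : 1 ≤ L) {z : Fin (d + 1) → ℤ} (hz : z ∈ box (per d L)) :
    coarse L z ∈ ({0, e 0} : Finset (Fin (d + 1) → ℤ)) := by
  rw [mem_box_per] at hz
  have hL0 : (0 : ℤ) < L := by exact_mod_cast hL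
  have hsucc : ∀ i : Fin d, z i.succ / (L : ℤ) = 0 := fun i =>
    Int.ediv_eq_zero_of_lt (hz.2 i).1 (hz.2 i).2
  rw [Finset.mem_insert, Finset.mem_singleton]
  by_cases h0 : z 0 < L
  · left
    funext ν
    refine Fin.cases ?_ (fun i => ?_) ν
    · simp only [coarse, Pi.zero_apply]; exact Int.ediv_eq_zero_of_lt hz.1.1 h0
    · simp only [coarse, Pi.zero_apply]; exact hsucc i
  · right
    funext ν
    refine Fin.cases ?_ (fun i => ?_) ν
    · simp only [coarse]
      rw [e_zero_apply_zero, Int.ediv_eq_iff_of_pos hL0]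
      constructor <;> linarith [hz.1.2]
    · simp only [coarse]; rw [e_zero_apply_succ]; exact hsucc i

/-- `Λ₀ = Ω₁^c = ∅`. [folklore] -/
private theorem lam_zero (L : ℕ) (hL : 1 ≤ L) : (twoBlock d L hL).lam 0 = ∅ := by
  ext y
  rw [Domains.mem_lam, zero_add, dom_one L hL]
  simp only [Finset.notMem_empty, iff_false, not_and, not_not]
  intro hy
  have hy' : y ∈ box (per d L) := by simpa [Domains.dom, twoBlock] using hy
  exact coarse_mem L hL hy'

/-- `Λ₁ = Ω₁^{(1)} = {0, e₀}`. [folklore] -/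
private theorem lam_one (L : ℕ) (hL : 1 ≤ L) : (twoBlock d L hL).lam 1 = {0, e 0} := by
  ext y
  rw [Domains.mem_lam, dom_one L hL, dom_two L hL]
  simp

/-- the block sums of the witness vanish: `Σ_{B¹(y)} λ = 0` for `y = 0, e₀`. [folklore] -/
private theorem blockSum_zero (L : ℕ) (hL : 1 ≤ L) {y : Fin (d + 1) → ℤ}
    (hy : y ∈ ({0, e 0} : Finset (Fin (d + 1) → ℤ))) :
    ∑ x ∈ ablock L y, lamW L x = 0 := by
  rw [ablock, sum_cell]
  unfold lamW
  rw [← Complex.ofReal_sum, Complex.ofReal_eq_zero]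
  simp only [cellPt]
  rcases Finset.mem_insert.mp hy with rfl | hy
  · simp only [Pi.zero_apply, mul_zero, zero_add]
    rw [sum_cube_first L (fun a : Fin L => cosTest L ((a : ℕ) : ℤ)), sum_fin_cosTest L hL, mul_zero]
  · rw [Finset.mem_singleton] at hy
    subst hy
    rw [e_zero_apply_zero, mul_one]
    have : ∀ j : Fin (d + 1) → Fin L, cosTest L ((L : ℤ) + ((j 0 : ℕ) : ℤ)) = cosTest L ((((j 0 : ℕ) : ℤ)) + L) :=
      fun j => by rw [add_comm]
    simp_rw [this, cosTest_add_L L hL]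
    rw [Finset.sum_neg_distrib, sum_cube_first L (fun a : Fin L => cosTest L ((a : ℕ) : ℤ)), sum_fin_cosTest L hL,
      mul_zero, neg_zero]

/-- **the witness lies in `N(Q′)`**. [cite: Balaban1984PropagatorsII, (2.7) p.224] -/
theorem nq_lamW (L : ℕ) (hL : 1 ≤ L) : (twoBlock d L hL).NQ (lamW L) := by
  intro j hj y hy
  have hk : (twoBlock d L hL).k = 1 := rfl
  rw [hk] at hj
  rcases Nat.le_one_iff_eq_zero_or_eq_one.mp hj with rfl | rfl
  · rw [lam_zero L hL] at hy; simp at hy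
  · rw [lam_one L hL] at hy
    show qAvg L 1 y (lamW L) = 0
    rw [qAvg_eq_zero_iff hL, pow_one]
    exact blockSum_zero L hL hy

/-- `B¹(Λ₁) = T_η`. [folklore] -/
private theorem blk_one (L : ℕ) (hL : 1 ≤ L) : (twoBlock d L hL).blk 1 = box (per d L) := by
  have h := (twoBlock d L hL).biUnion_blk
  have hk : (twoBlock d L hL).k = 1 := rfl
  rw [hk, show Finset.range (1 + 1) = {0, 1} by rfl, Finset.biUnion_insert, Finset.singleton_biUnion] at h
  have h0 : (twoBlock d L hL).blk 0 = ∅ := by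
    rw [Domains.blk, lam_zero L hL, Finset.biUnion_empty]
  rw [h0, Finset.empty_union] at h
  exact h

/-- the witness has positive mass on `T_η` (`L ≥ 2`). [folklore] -/
private theorem mass_pos (L : ℕ) (hL2 : 2 ≤ L) : 0 < ∑ z ∈ box (per d L), ‖lamW L z‖ ^ 2 := by
  have h0 : (0 : Fin (d + 1) → ℤ) ∈ box (per d L) := by
    rw [mem_box_per]
    have : (0 : ℤ) < L := by exact_mod_cast (show 0 < L by omega)
    refine ⟨⟨le_rfl, by simp only [Pi.zero_apply]; linarith⟩, fun i => ⟨le_rfl, by simpa using this⟩⟩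
  have hpos : 0 < ‖lamW L (0 : Fin (d + 1) → ℤ)‖ ^ 2 := by
    unfold lamW
    rw [Complex.norm_real, Real.norm_eq_abs, sq_abs]
    have := cosTest_zero_pos hL2
    simp only [Pi.zero_apply]
    positivity
  exact lt_of_lt_of_le hpos (Finset.single_le_sum (f := fun z => ‖lamW (d := d) L z‖ ^ 2) (fun z _ => by positivity) h0)

/-- the witness is a function on the torus `T_η = Π ℤ/(per L)`. [folklore] -/
private theorem lamW_periodic (L : ℕ) (hL : 1 ≤ L) : IsPeriodic (per d L) (lamW (d := d) L) := by
  intro z m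
  unfold lamW
  rw [MultiPeriod.translate_apply, per_zero]
  push_cast
  rw [show z 0 + 2 * (L : ℤ) * m 0 = z 0 + 2 * L * m 0 by ring, cosTest_add_period L hL]

/-- the eigen-relation: `Δλ = (2 − 2cos(π/L))·λ` on the whole lattice (direction `0` by `B6LayerCosine.cosTest_eigen`,
the other directions contribute nothing). [folklore] -/
private theorem negLap_lamW (L : ℕ) (hL : 1 ≤ L) (z : Fin (d + 1) → ℤ) :
    negLap 1 (lamW (d := d) L) z = ((2 - 2 * Real.cos (π / L) : ℝ) : ℂ) * lamW L z := by
  unfold negLap lamW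
  rw [Fin.sum_univ_succ]
  have hsucc : ∀ i : Fin d,
      (2 * (cosTest L (z 0) : ℂ) - (cosTest L ((z + e i.succ) 0) : ℂ) - (cosTest L ((z - e i.succ) 0) : ℂ)) = 0 :=
    fun i => by
      have : (e i.succ : Fin (d + 1) → ℤ) 0 = 0 := by simp [e, (Fin.succ_ne_zero i).symm]
      simp only [Pi.add_apply, Pi.sub_apply, this, add_zero, sub_zero]
      ring
  rw [Finset.sum_eq_zero fun i _ => hsucc i, add_zero]
  simp only [Pi.add_apply, Pi.sub_apply, e_zero_apply_zero]
  have heig := cosTest_eigen hL (z 0)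
  have : (cosTest L (z 0 + 1) : ℂ) + (cosTest L (z 0 - 1) : ℂ)
      = 2 * Complex.cos ((π : ℂ) / (L : ℂ)) * (cosTest L (z 0) : ℂ) := by
    rw [add_comm]; exact_mod_cast heig
  push_cast
  linear_combination -this

/-- **the energy of the witness**: `⟨λ,Δλ⟩_{T_η} = Σ_{x∈T_η}Σ_μ|λ(x+e_μ) − λ(x)|² = (2 − 2cos(π/L))·Σ_{x∈T_η}|λ(x)|²`
(lattice units). [folklore] -/
private theorem energy_lamW (L : ℕ) (hL : 1 ≤ L) : ∑ z ∈ box (per d L), ∑ μ : Fin (d + 1), ‖lamW L (z + e μ) - lamW L z‖ ^ 2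
    = (2 - 2 * Real.cos (π / L)) * ∑ z ∈ box (per d L), ‖lamW (d := d) L z‖ ^ 2 := by
  have hP : ∀ i, 1 ≤ per d L i := fun i => by
    refine Fin.cases ?_ (fun i => ?_) i
    · rw [per_zero]; omega
    · rw [per_succ]; exact hL
  have h := inner_negLap_eq_fwd' hP (lamW_periodic L hL)
  rw [Finset.sum_congr rfl fun z _ => by rw [negLap_lamW L hL z]] at h
  have h2 : ∑ z ∈ box (per d L), conj (lamW L z) * (((2 - 2 * Real.cos (π / L) : ℝ) : ℂ) * lamW (d := d) L z)
      = (((2 - 2 * Real.cos (π / L)) * ∑ z ∈ box (per d L), ‖lamW (d := d) L z‖ ^ 2 : ℝ) : ℂ) := by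
    push_cast
    rw [Finset.mul_sum]
    refine Finset.sum_congr rfl fun z _ => ?_
    rw [← Complex.conj_mul']
    ring
  rw [h2] at h
  exact_mod_cast h.symm

/-- **THE PRINTED CONSTANT `π²` OF (2.11) IS REFUTED** on the admitted geometry `twoBlock L` (every `L ≥ 2`, every
dimension): for the witness `λ ∈ N(Q′)`, `π²·Σ_{j=1}^k (L^j)^{−2}Σ_{x∈B^j(Λ_j)}|λ(x)|² = π²L^{−2}‖λ‖²` EXCEEDS
`⟨λ,Δλ⟩ = 4sin²(π/2L)‖λ‖²` (`B6LayerCosine.sin_bound_lt_pi_sq_div`).  The valid constant is `8` (`B6Eq211.ineq211`).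
[cite: Balaban1984PropagatorsII, (2.11) p.225] -/
theorem not_ineq211_pi_sq (L : ℕ) (hL : 1 ≤ L) (hL2 : 2 ≤ L) :
    ¬ (π ^ 2 * ∑ j ∈ Finset.Icc 1 (twoBlock d L hL).k,
          ((((twoBlock d L hL).L : ℝ) ^ j) ^ 2)⁻¹ * ∑ x ∈ (twoBlock d L hL).blk j, ‖lamW L x‖ ^ 2
        ≤ ∑ z ∈ (twoBlock d L hL).T, ∑ μ : Fin (d + 1), ‖lamW L (z + e μ) - lamW L z‖ ^ 2) := by
  intro H
  have hk : (twoBlock d L hL).k = 1 := rfl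
  have hLL : (twoBlock d L hL).L = L := rfl
  have hT : (twoBlock d L hL).T = box (per d L) := rfl
  rw [hk, hLL, hT, show Finset.Icc 1 1 = {1} by rfl, Finset.sum_singleton, pow_one, blk_one L hL,
    energy_lamW L hL] at H
  set M := ∑ z ∈ box (per d L), ‖lamW (d := d) L z‖ ^ 2 with hM
  have hMpos : 0 < M := mass_pos L hL2
  have hL0 : (0 : ℝ) < L := by exact_mod_cast hL
  -- H : π² L⁻² M ≤ (2 − 2cos(π/L)) M, whereas L(2 − 2cos(π/L)) = 4L sin²(π/2L) < π²/L
  have hsin := sin_bound_lt_pi_sq_div (L := L) hL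
  rw [← two_sub_two_cos_eq (L := L) hL] at hsin
  have h1 : π ^ 2 * ((L : ℝ) ^ 2)⁻¹ ≤ 2 - 2 * Real.cos (π / L) := le_of_mul_le_mul_right (by linarith) hMpos
  have h2 : (L : ℝ) * (2 - 2 * Real.cos (π / L)) < π ^ 2 / L := hsin
  have h3 : (L : ℝ) * (π ^ 2 * ((L : ℝ) ^ 2)⁻¹) = π ^ 2 / L := by field_simp
  have h4 := mul_le_mul_of_nonneg_left h1 hL0.le
  rw [h3] at h4
  linarith

/-- Hence **(2.11) AS PRINTED (constant `π²`) IS FALSE** as a statement about all admitted geometries and all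
`λ ∈ N(Q′)`, in every dimension `d + 1 ≥ 1` — while `B6Eq211.ineq211` proves it with the constant `8`.
[cite: Balaban1984PropagatorsII, (2.11) p.225] -/
theorem not_forall_ineq211_pi_sq (d : ℕ) :
    ¬ ∀ (G : Domains (d + 1)) (lam' : (Fin (d + 1) → ℤ) → ℂ), G.NQ lam' →
        π ^ 2 * ∑ j ∈ Finset.Icc 1 G.k, (((G.L : ℝ) ^ j) ^ 2)⁻¹ * ∑ x ∈ G.blk j, ‖lam' x‖ ^ 2
          ≤ ∑ z ∈ G.T, ∑ μ : Fin (d + 1), ‖lam' (z + e μ) - lam' z‖ ^ 2 := fun H =>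
  not_ineq211_pi_sq 2 (by norm_num) (by norm_num) (H (twoBlock d 2 (by norm_num)) (lamW 2) (nq_lamW 2 (by norm_num)))

end Witness

end

end Literature.MathematicalPhysics.QuantumFieldTheory.Balaban1983to89.B6Eq211PiSqRefuted
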